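import Literature.AnabelianGeometry.AbsoluteAnabelian.FundamentalExtensionProSigmaGeomModel
import Literature.AnabelianGeometry.AbsoluteAnabelian.MLFGaloisGroupsHolds
import Literature.AnabelianGeometry.AbsoluteAnabelian.AbsTopIThm26vHolds
import Literature.AnabelianGeometry.AbsoluteAnabelian.AbsTopIThm26vSplitFreeInstances
import HarnessLib

/-!
# [AbsAnab] §1.3 p. 19 «`q₁ = q₂`» (FACT-LIST F-0009 `SameResidueCard`) — instance forms at the
# MLF model classes of the tree, composed BY NAME

S. Mochizuki, *The Absolute Anabelian Geometry of Hyperbolic Curves* (2004) [MochizukiAbsAnab2004]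
(manuscript pagination, lit key `paper:url-e8f118cc205e`), §1.3 p. 19, the sentence between Lemma 1.3.8
and Lemma 1.3.9: «Thus, Lemma 1.3.8, Proposition 1.2.1, (v), imply that `q₁ = q₂`» (for hyperbolic curves
`(Xᵢ)_{Kᵢ}` over finite extensions `Kᵢ/ℚ_{pᵢ}` with `Π_{(X₁)_{K₁}} ≅ Π_{(X₂)_{K₂}}`, the residue
cardinalities agree).

PROOF-ONLY file (theorems only; no definition, no instance, no named fact; abc-iut cell, D-0079 L-F
sub-cell [AbsTop*]+[AbsAnab], row «LF-ABSTOP F-0009», seat abc-iut-w5-d162 g6).  The typed row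
`FundamentalExtension.SameResidueCard B₁ B₂` is a PREDICATE on two MLF base data; its universal closure
is refuted (`not_forall_sameResidueCard`, abc-iut-f-052) and the tree proves it from the conclusion of
Lemma 1.3.8 with NO named input (`sameResidueCard_of_preservesGeom'`, abc-iut-L4).  What was missing as
explicit kernel statements are the compositions with the tree's instance forms of Lemma 1.3.8 / [AbsTopI]
Thm 2.6 (iv)(v) (row F-0007 `PreservesGeom`), i.e. «`q₁ = q₂`» for EVERY isomorphism `Π₁ ⥲ Π₂` at the
model classes where `Δ ⊆ Π` is already known to be group-theoretic:

* `MLFBase.sameResidueCard_of_geomTFG_of_isProSet` — MLF base data, `Δ` topologically finitely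
  generated and pro-`Σ` with `Σ ⊊ Primes` on both sides ([AbsTopI] Thm 2.6 (iv) route, elasticity of
  `G_k` discharged: `MLFBase.preservesGeom`): UNCONDITIONAL;
* `MLFBase.sameResidueCard_of_isProSigmaCompletion_puncturedSurfaceGroup` — the surface-group model
  class (`Δ` a pro-`Σ` completion of `Γ_{g,r}`, `Σ ⊊ Primes`): UNCONDITIONAL;
* `MLFBase.sameResidueCard_of_starCondition` / `MLFBase.sameResidueCard_of_coinvariantRankConstant` —
  PROFINITE `Δ` under the printed hypotheses of [AbsAnab] Lemma 1.1.4 (ii) (splitting over an open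
  subgroup, `Δ` tfg, condition (∗) = the content of Lemma 1.1.5 «Tate modules of semi-abelian
  varieties», the one printed input not typed in the tree) — this is print's own route p. 19 l.2–3
  («follows formally from Lemmas 1.1.4, 1.1.5» + Prop 1.2.1 (v)), CONDITIONAL exactly on (∗);
* `sameResidueCard_split_profiniteCompletion_freeGroup` — at the split free models
  `F̂_n × G_K ⥲ F̂_m × G_L` (NON-ABELIAN profinite `Δ`, (∗) discharged by abc-iut-f-090's
  `starCondition_holds`): UNCONDITIONAL (honest label: trivial outer action, a satisfiability witness,
  not the `π₁` of a curve).

Genuine carrier (`Π_X` of an actual hyperbolic curve over an MLF) is not constructible in the tree (no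
étale `π₁`); nothing here restates a refuted universal closure.  Classical, refereed [AbsAnab]/[AbsTopI]
material; nothing here bears on [IUTchIII] Cor. 3.12 or takes a side.
-/

noncomputable section

open Topology Field

namespace Literature.AnabelianGeometry.AbsoluteAnabelian

namespace FundamentalExtension

open Literature.AnabelianGeometry.SemiGraphs.SemiGraphOfAnabelioids
open Literature.GroupTheory.CombinatorialGroupTheory
open Literature.IUT.HodgeTheaters (profiniteCompletion)

variable {E F : FundamentalExtension.{0}}

/-! ### [AbsTopI] Thm 2.6 (iv) route: `Σ ⊊ Primes` -/

/-- **«`q₁ = q₂`» for pro-`Σ` geometric subgroups, `Σ ⊊ Primes`** ([AbsAnab] §1.3 p. 19 via [AbsTopI]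
Thm 2.6 (iv)): for two extensions with MLF base data whose `Δ` are topologically finitely generated and
pro-`Σ` / pro-`T` with `Σ, T ⊊ Primes`, EVERY isomorphism of topological groups `Π_E ⥲ Π_F` forces equal
residue cardinalities of the base fields. [cite: MochizukiAbsAnab2004, §1.3 p.19] -/
theorem MLFBase.sameResidueCard_of_geomTFG_of_isProSet (BE : E.MLFBase) (BF : F.MLFBase)
    (hΔE : E.GeomTFG) (hΔF : F.GeomTFG) {S T : Set ℕ} (hS : S ⊆ {q | q.Prime})
    (hS' : S ≠ {q | q.Prime}) (hES : IsProSet E.geom S) (hT : T ⊆ {q | q.Prime})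
    (hT' : T ≠ {q | q.Prime}) (hFT : IsProSet F.geom T) (φ : E.arith ≃ₜ* F.arith) :
    SameResidueCard BE BF :=
  sameResidueCard_of_preservesGeom' BE BF (MLFBase.preservesGeom BE BF hΔE hΔF hS hS' hES hT hT' hFT φ)

/-- **«`q₁ = q₂`» at the surface-group model class** ([AbsAnab] §1.3 p. 19): for two extensions with
MLF base data whose geometric subgroups are pro-`Σ` / pro-`T` completions of punctured surface groups
with `Σ, T ⊊ Primes`, EVERY isomorphism `Π_E ⥲ Π_F` forces equal residue cardinalities.
[cite: MochizukiAbsAnab2004, §1.3 p.19] -/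
theorem MLFBase.sameResidueCard_of_isProSigmaCompletion_puncturedSurfaceGroup (BE : E.MLFBase)
    (BF : F.MLFBase) {Sigma : Set ℕ} {g r : ℕ} {ι : PuncturedSurfaceGroup g r →* E.geom}
    (hι : IsProSigmaCompletion Sigma ι) {T : Set ℕ} {g' r' : ℕ}
    {κ : PuncturedSurfaceGroup g' r' →* F.geom} (hκ : IsProSigmaCompletion T κ)
    (hS : Sigma ⊆ {q | q.Prime}) (hS' : Sigma ≠ {q | q.Prime}) (hT : T ⊆ {q | q.Prime})
    (hT' : T ≠ {q | q.Prime}) (φ : E.arith ≃ₜ* F.arith) : SameResidueCard BE BF :=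
  sameResidueCard_of_preservesGeom' BE BF
    (MLFBase.preservesGeom_of_isProSigmaCompletion_puncturedSurfaceGroup BE BF hι hκ hS hS' hT hT' φ)

/-! ### Print's route ([AbsAnab] p. 19 l.2–3): profinite `Δ`, conditional on (∗) -/

/-- **«`q₁ = q₂`» for PROFINITE `Δ` under the printed hypotheses of [AbsAnab] Lemma 1.1.4 (ii)**
(print p. 19: Lemma 1.3.8 «follows formally from Lemmas 1.1.4, 1.1.5», then Prop 1.2.1 (v)): for two
extensions with MLF base data, each splitting over an open subgroup of `G`, with `Δ` topologically
finitely generated and satisfying condition (∗) (`StarCondition` — in print supplied by Lemma 1.1.5),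
EVERY isomorphism `Π_E ⥲ Π_F` forces equal residue cardinalities.  CONDITIONAL exactly on (∗).
[cite: MochizukiAbsAnab2004, §1.3 p.19] -/
theorem MLFBase.sameResidueCard_of_starCondition (BE : E.MLFBase) (BF : F.MLFBase)
    (hsE : E.SplitsOverOpenSubgroup) (hE : IsTopologicallyFinitelyGenerated E.geom)
    (hstarE : E.StarCondition) (hsF : F.SplitsOverOpenSubgroup)
    (hF : IsTopologicallyFinitelyGenerated F.geom) (hstarF : F.StarCondition)
    (φ : E.arith ≃ₜ* F.arith) : SameResidueCard BE BF :=
  sameResidueCard_of_preservesGeom' BE BF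
    (preservesGeom_of_starCondition BE BF hsE hE hstarE hsF hF hstarF φ)

/-- **«`q₁ = q₂`» under `CoinvariantRankConstant`** (the p. 8 reduction form of condition (∗); [AbsTopI]
Thm 2.6 (v) route): MLF base data, `Δ` topologically finitely generated with constant coinvariant rank
on both sides ⇒ every `Π_E ⥲ Π_F` forces equal residue cardinalities.
[cite: MochizukiAbsAnab2004, §1.3 p.19] -/
theorem MLFBase.sameResidueCard_of_coinvariantRankConstant (BE : E.MLFBase) (BF : F.MLFBase)
    (hE : IsTopologicallyFinitelyGenerated E.geom) (hcE : E.CoinvariantRankConstant)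
    (hF : IsTopologicallyFinitelyGenerated F.geom) (hcF : F.CoinvariantRankConstant)
    (φ : E.arith ≃ₜ* F.arith) : SameResidueCard BE BF :=
  sameResidueCard_of_preservesGeom' BE BF
    (preservesGeom_of_coinvariantRankConstant BE BF hE hcE hF hcF φ)

/-! ### The split free models `F̂_n × G_K` (non-abelian profinite `Δ`, unconditional) -/

/-- **«`q₁ = q₂`» at the split free models**: if `F̂_n × G_K ≅ F̂_m × G_L` as topological groups
(`K/ℚ_p`, `L/ℚ_q` finite), the residue cardinalities of `K` and `L` agree — `SameResidueCard` of the
base data `(p, K, refl)`, `(q, L, refl)`; all printed hypotheses of Lemma 1.1.4 (ii) hold here, (∗) by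
`starCondition_holds`.  HONEST LABEL: trivial outer action (a satisfiability witness with non-abelian
`Δ`, not the `π₁` of a curve). [cite: MochizukiAbsAnab2004, §1.3 p.19] -/
theorem sameResidueCard_split_profiniteCompletion_freeGroup (n p : ℕ) [Fact p.Prime] (K : Type)
    [Field K] [CharZero K] [Algebra ℚ_[p] K] [FiniteDimensional ℚ_[p] K] (m q : ℕ) [Fact q.Prime]
    (L : Type) [Field L] [CharZero L] [Algebra ℚ_[q] L] [FiniteDimensional ℚ_[q] L]
    (φ : (⟨ProfiniteGrp.of (profiniteCompletion (FreeGroup (Fin n)) × absoluteGaloisGroup K),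
        absoluteGaloisGrp K,
        ContinuousMonoidHom.snd (profiniteCompletion (FreeGroup (Fin n))) (absoluteGaloisGroup K),
        Prod.snd_surjective⟩ : FundamentalExtension.{0}).arith ≃ₜ*
      (⟨ProfiniteGrp.of (profiniteCompletion (FreeGroup (Fin m)) × absoluteGaloisGroup L),
        absoluteGaloisGrp L,
        ContinuousMonoidHom.snd (profiniteCompletion (FreeGroup (Fin m))) (absoluteGaloisGroup L),
        Prod.snd_surjective⟩ : FundamentalExtension.{0}).arith) :
    SameResidueCard
      (E := (⟨ProfiniteGrp.of (profiniteCompletion (FreeGroup (Fin n)) × absoluteGaloisGroup K),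
        absoluteGaloisGrp K,
        ContinuousMonoidHom.snd (profiniteCompletion (FreeGroup (Fin n))) (absoluteGaloisGroup K),
        Prod.snd_surjective⟩ : FundamentalExtension.{0}))
      (F := (⟨ProfiniteGrp.of (profiniteCompletion (FreeGroup (Fin m)) × absoluteGaloisGroup L),
        absoluteGaloisGrp L,
        ContinuousMonoidHom.snd (profiniteCompletion (FreeGroup (Fin m))) (absoluteGaloisGroup L),
        Prod.snd_surjective⟩ : FundamentalExtension.{0}))
      { p := p, K := K, galIso := ContinuousMulEquiv.refl _ }
      { p := q, K := L, galIso := ContinuousMulEquiv.refl _ } :=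
  sameResidueCard_of_preservesGeom' _ _ (preservesGeom_split_profiniteCompletion_freeGroup n p K m q L φ)

end FundamentalExtension

end Literature.AnabelianGeometry.AbsoluteAnabelian

end
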